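import Summits.BirchSwinnertonDyer.Rank1Residual.P2.CongruentNumberSilentEvenFiveThetaCMBeta
import Literature.NumberTheory.EllipticCurves.TianYuanZhang2017.CMPointClassFieldBetaField
import HarnessLib

/-!
# Cell `bsd-monsky` (typer), route B: C-P2-1 on `𝒮⁻` from the FOUR-TIMES-REDUCED class-field display ALONE — the offered
# corner (`…_of_cmPointClassFieldDataBeta_descent (hCF‴)`, OFFER-M v1.17) with the inclusion «`A[2] ⊆ (β+1)A[4]`» of
# the `β′`-facts struck as well (so the whole printed identity «`(β+1)A[4] = A[2]`» is kernel work)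

HONEST FRAMING (cell `bsd-monsky`, run/shared/lean/pub/bsd-monsky/; README §1): ONE theorem on ONE explicit infinite
family of quadratic twists of the congruent number curve at the prime `2`; not "BSD for rank ≤ 1", nothing at odd primes;
nothing is booked by this file. The corner of record of route B (referee B ROUND 896, 2026-08-27T18:38Z) is
`congruentSilentEvenFiveBSDTwo_of_cmPointClassFieldDataTorsion_descent (hCF″)`; the corner offered in OFFER-M v1.17 is
`congruentSilentEvenFiveBSDTwo_of_cmPointClassFieldDataBeta_descent (hCF‴)`. A fourth derivability pass
(`Literature/…/TianYuanZhang2017/CMPointClassFieldBetaField.lean`) found the inclusion «`A[2] ⊆ (β+1)A[4]`» (`n` even) of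
the displayed `β′`-facts — the second half of the printed identity «`(β+1)A[4] = A[2]`», TYZ p0020 L146 — to be a kernel
theorem of the displayed «`β` acts on `ℚ(i)` trivially» and the `4`-torsion of `A` as well (`β(√2) = ±√2`; on the explicit
half `ptQ` of `(2i, 0)`, `β(ptQ) = ptQ` or `ptQ + (0, 0)`, so `(β+1)` maps `{ptQ, ptQ + τ(1/2)}` onto `{(2i, 0), (−2i, 0)}`
and `τ(1/2)` to `(0, 0)`); `tyz_cmPointClassFieldDataBetaField` (`hCF⁗`) is `hCF‴` without that inclusion, and the named
facts are EQUIVALENT in the kernel (`tyz_cmPointClassFieldDataBeta_iff_betaField`, `tyz_cmPointClassFieldData_iff_betaField`).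
This file is the corner on the four-times-reduced display:
`congruentSilentEvenFiveBSDTwo_of_cmPointClassFieldDataBetaField_descent (hCF⁗)`, with the sharper form, clause (a) and
the pair form from the same binder (proofs: one-line compositions of the v1.17 corner / its twins with
`tyz_cmPointClassFieldDataBeta_of_betaField`). Marks of record untouched (route B: NONE). CONDITIONAL on the one
(four-times-reduced) display; nothing asserted; the conjecture `Prop`s stay `@[conjecture]`.
[cite: TianYuanZhang2017, §3.1 (J738–J739), Prop. 3.2 (1)(2)(3), Prop. 3.4, Thm. 3.5 (J741) and its proof (p0020 L106–L165, p0021 L1–L5), Thm. 3.6 (1)(2), Lemma 3.16 (p0017 L98–L113), Lemma 3.17 (p0017 L136–L149), Lemma 3.18 (p0017 L152–L153), Lemma 3.21 and its proof (J759)]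
[cite: Cox2013, Theorem 6.1 (ii) and Theorem 9.18] [cite: SilvermanAEC2009, III.2.3, III.6.4, Prop. X.1.4, Prop. X.4.9, Thm. X.4.2]
[cite: Miller2011LMS, Def. 1.1 (arXiv:1010.2431 p. 3)]
-/

noncomputable section

open scoped Classical

open WeierstrassCurve Literature.NumberTheory.EllipticCurves
  Literature.NumberTheory.EllipticCurves.TianYuanZhang2017

set_option autoImplicit false

namespace Summit.BirchSwinnertonDyer.Rank1Residual.P2

open Conjectures

/-! ## §1 C-P2-1 on `𝒮⁻` from the four-times-reduced class-field display ALONE -/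

/-- **C-P2-1 = Theorem 1.1 on `𝒮⁻` (`ord_{s=1} L(E_{2pq}, s) = 1 ∧ BSD(E_{2pq}, 2)`) from `tyz_cmPointClassFieldDataBetaField`
ALONE** — the v1.17 corner (`…_of_cmPointClassFieldDataBeta_descent (hCF‴)`) with the inclusion «`A[2] ⊆ (β+1)A[4]`» of
the `β′`-facts struck from the displayed hypothesis as well (a kernel theorem of «`β(i) = i`» and the `4`-torsion of `A`);
the `2`-Selmer input is the tree's complete `2`-descent. CONDITIONAL on the one display; nothing asserted.
[cite: TianYuanZhang2017, §1 ((1.1)), Thm. 3.5 and its proof (p0020 L106–p0021 L5), Prop. 3.2, Thm. 3.6, Lemma 3.16, Lemma 3.17, Lemma 3.18]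
[cite: Cox2013, Theorem 6.1 (ii) and Theorem 9.18] [cite: SilvermanAEC2009, III.2.3, III.6.4, Prop. X.1.4, Prop. X.4.9, Thm. X.4.2]
[cite: Miller2011LMS, Def. 1.1 (arXiv:1010.2431 p. 3)] -/
theorem congruentSilentEvenFiveBSDTwo_of_cmPointClassFieldDataBetaField_descent
    (hCF : tyz_cmPointClassFieldDataBetaField) : CongruentSilentEvenFiveBSDTwo :=
  congruentSilentEvenFiveBSDTwo_of_cmPointClassFieldDataBeta_descent
    (tyz_cmPointClassFieldDataBeta_of_betaField hCF)

/-! ## §2 The sharper form, clause (a) and the pair form from the four-times-reduced display ALONE -/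

/-- **C-P2-1, sharper (`Ш_an`-unit) form, on `𝒮⁻` from `tyz_cmPointClassFieldDataBetaField` ALONE.** CONDITIONAL; nothing
asserted. [cite: TianYuanZhang2017, §1 ((1.1)), Thm. 3.5, Prop. 3.2, Thm. 3.6, Lemma 3.17, Lemma 3.18] [cite: Cox2013, Theorem 6.1 (ii) and Theorem 9.18]
[cite: SilvermanAEC2009, Prop. X.1.4, Prop. X.4.9] -/
theorem congruentSilentEvenFiveOrdTwo_of_cmPointClassFieldDataBetaField_descent
    (hCF : tyz_cmPointClassFieldDataBetaField) : CongruentSilentEvenFiveOrdTwo :=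
  congruentSilentEvenFiveOrdTwo_of_cmPointClassFieldDataBeta_descent
    (tyz_cmPointClassFieldDataBeta_of_betaField hCF)

/-- **Clause (a) on all of `𝒮⁻` from the four-times-reduced display alone**: `ord_{s=1} L(E_{2pq}, s) = 1`. CONDITIONAL;
nothing asserted. [cite: TianYuanZhang2017, Thm. 3.5, Prop. 3.2, Thm. 3.6, Lemma 3.17, Lemma 3.18, Lemma 3.21] [cite: Cox2013, Theorem 6.1 (ii) and Theorem 9.18] -/
theorem analyticRank_eq_one_sMinus_of_cmPointClassFieldDataBetaField (hCF : tyz_cmPointClassFieldDataBetaField)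
    {p q : ℕ} (hp : p.Prime) (hq : q.Prime) (hp5 : p % 8 = 5) (hq4 : q % 4 = 3) (hj : jacobiSym p q = -1) :
    (congruentNumberCurve (2 * (p * q))).analyticRank = 1 :=
  analyticRank_eq_one_sMinus_of_cmPointClassFieldDataBeta (tyz_cmPointClassFieldDataBeta_of_betaField hCF) hp hq
    hp5 hq4 hj

/-- **Both typed forms of C-P2-1 on `𝒮⁻` from `tyz_cmPointClassFieldDataBetaField` ALONE.** CONDITIONAL; nothing asserted.
[cite: TianYuanZhang2017, Thm. 3.5, Prop. 3.2, Thm. 3.6, Lemma 3.17, Lemma 3.18] [cite: Cox2013, Theorem 6.1 (ii) and Theorem 9.18]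
[cite: SilvermanAEC2009, Prop. X.1.4, Prop. X.4.9] -/
theorem congruentSilentEvenFive_pair_of_cmPointClassFieldDataBetaField_descent
    (hCF : tyz_cmPointClassFieldDataBetaField) : CongruentSilentEvenFiveOrdTwo ∧ CongruentSilentEvenFiveBSDTwo :=
  ⟨congruentSilentEvenFiveOrdTwo_of_cmPointClassFieldDataBetaField_descent hCF,
    congruentSilentEvenFiveBSDTwo_of_cmPointClassFieldDataBetaField_descent hCF⟩

/-! ## §3 The corners are interchangeable (the displayed facts are equivalent in the kernel) -/

/-- **The thrice- and four-times-reduced corners are the same theorem read through equivalent displays**: C-P2-1 follows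
from `hCF‴` iff it follows from `hCF⁗` (`tyz_cmPointClassFieldDataBeta_iff_betaField`). [cite: TianYuanZhang2017, §3, proof of Thm. 3.5 (2)] -/
theorem cmPointClassFieldDataBeta_imp_bsdTwo_iff_betaField_imp_bsdTwo :
    (tyz_cmPointClassFieldDataBeta → CongruentSilentEvenFiveBSDTwo) ↔
      (tyz_cmPointClassFieldDataBetaField → CongruentSilentEvenFiveBSDTwo) :=
  ⟨fun h hB => h (tyz_cmPointClassFieldDataBeta_of_betaField hB),
    fun h hT => h (tyz_cmPointClassFieldDataBetaField_of_beta hT)⟩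

end Summit.BirchSwinnertonDyer.Rank1Residual.P2

end
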